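import Literature.AlgebraicGeometry.Motives.HirschowitzIyerStrongPlanes
import HarnessLib

/-!
# The Gysin map of the pair `V₊(Q, C) ⊂ V₊(Q)` on cycles contained in `V₊(Q, C)`

Hirschowitz–Iyer, *Hilbert schemes of fat r-planes and the triviality of Chow groups of complete
intersections* [HirschowitzIyer2010], §2: for the pair `Y = V₊(Q, C) ⊂ Y' = V₊(Q)` (`Y` the
Cartier divisor cut on the integral `Y'` by the form `C` of degree `e`, `Y ∈ |𝒪_{Y'}(e)|`) and an
`(r+1)`-cycle `Γ` on `Y'`, "the intersection product `Γ · Y` is a class in `CH_r(|Γ| ∩ Y)`" (Fulton,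
*Intersection Theory*, Def. 2.3 / 2.4.1); the tree's `quadricCubicGysin`
(`Motives/HirschowitzIyerQuadricCubicGysin`) is `[Γ] ↦ Γ · Y ∈ CH_r(Y)`. In the proof of HI's
Lemma 2.2 (case `s < r`) the cycle `Γ = pr_{2*}(H'_Z)` is swept out by strong planes lying IN `Y`,
so `|Γ| ⊆ Y = |D|` and `Γ · Y` is not a proper intersection: by Fulton's definition it is
`c₁(𝒪_{Y'}(Y)|_Γ) ∩ [Γ]`, and since `𝒪_{Y'}(Y) = 𝒪(e)|_{Y'}`, it is `e` times a hyperplane section of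
`Γ`. This file proves exactly that, generalising the strong-planes-inside-`Y` case
`quadricCubicGysin_mk_primeCycle_eq_smul_of_subset` of `Motives/HirschowitzIyerStrongPlanes` from
planes to arbitrary subvarieties:

* `CartierDivisor.smul_primeInter` — `(n • D) · [V] = n • (D · [V])` as cycles for `V ⊄ |D|`
  (Fulton, Prop. 2.3 (b));
* `quadricCubic_gysinCycle_primeCycle_sub_smul_mem_ratTrivial` — **for a subvariety
  `V = closure {w} ⊆ V₊(Q)` of dimension `d + 1` CONTAINED in `V₊(C)` and a linear form `m` not
  vanishing on `V`, `Y · [V] - e • (V₊(m)|_{V₊(Q)} · [V])|_Y ∈ Rat_d(Y)`**: the representative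
  `V₊(C)|_V` of the class `𝒪(e)|_V` is replaced by the linearly equivalent honest divisor
  `(e • V₊(m))|_V`, whose cycle is `e • (V₊(m) · [V])`; the difference of the two cycles is rationally
  trivial on `V ⊆ Y` (Fulton, Thm. 2.4 / Cor. 2.4.1 are not needed here: both divisors are pulled
  back to the same `V`);
* `quadricCubicGysin_mk_primeCycle_eq_smul_of_closure_subset` — the same in `CH_d(V₊(Q, C))`:
  **`quadricCubicGysin [V] = e • [(V₊(m) · [V])|_Y]`**.

This is the form in which `Γ · Y` is computed in HI's Lemma 2.2 for `s < r` ("this linear system has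
degree `d` along the fibers", p. 5 of arXiv:0903.5018), the hyperplane section `V₊(m) · [Γ]` being
then evaluated by the projection formula along the ruled surface.

## References

* A. Hirschowitz, J. N. N. Iyer, *Hilbert schemes of fat r-planes and the triviality of Chow groups
  of complete intersections*, Contemp. Math. 522 (2010), doi:10.1090/conm/522/10291,
  arXiv:0903.5018, §2 (Lemma 2.2). [HirschowitzIyer2010]
* W. Fulton, *Intersection Theory*, 2nd ed. (1998), Def. 2.3, Prop. 2.3 (b), Def. 2.4.1.
  [Fulton1998]
-/

noncomputable section

universe u

open CategoryTheory AlgebraicGeometry Order Topology TopologicalSpace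
open Literature.AlgebraicGeometry.Motives.Segre Literature.AlgebraicGeometry.Motives.RatFn

attribute [local instance] MvPolynomial.gradedAlgebra

namespace Literature.AlgebraicGeometry.Motives

/-! ### `(n • D) · [V] = n • (D · [V])` -/

namespace CartierDivisor

variable {K : Type u} [Field K] {X : SchemeOver K} [IsIntegral X.left] [LocallyOfFiniteType X.hom]

/-- **`(n • D) · [V] = n • (D · [V])`** as cycles, for `V = closure {z} ⊄ |D|` (additivity of
`D ↦ D · [V]` on honest restrictions, Fulton Prop. 2.3 (b), iterated).
[cite: Fulton1998, Prop. 2.3 (b) (p. 34)] -/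
theorem smul_primeInter (D : CartierDivisor X.left) {z : X.left} (hD : D.Avoids z) (n : ℕ) :
    (n • D).primeInter z = (n : ℤ) • D.primeInter z := by
  induction n with
  | zero =>
    rw [(zero_smul_sameDivisor D).primeInter_eq (hD.smul 0), zero_primeInter]
    simp
  | succ n ih =>
    rw [(add_smul_sameDivisor D n 1).primeInter_eq (hD.smul (n + 1)),
      primeInter_add (hD.smul n) (hD.smul 1), ih, one_smul]
    push_cast
    rw [add_zsmul, one_zsmul]

end CartierDivisor

/-! ### The Gysin map on subvarieties of `V₊(Q)` contained in `V₊(C)` -/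

section Inside

variable {n : ℕ} {K : Type u} [Field K] {Q C : MvPolynomial (Fin (n + 1)) K}
  [IsIntegral (quadric Q).left] {e : ℕ}

/-- **`Y · [V] ≡ e • (V₊(m) · [V])|_Y` modulo `Rat_d(Y)`** for a `(d+1)`-dimensional subvariety
`V = closure {w}` of `Y' = V₊(Q)` CONTAINED in `V₊(C)` (hence in `Y = V₊(Q, C)`) and a linear form
`m` not vanishing identically on `V`: the Gysin cycle `Y · [V]` (Fulton's `D · [V]` for `V ⊆ |D|`,
through the representative `CartierDivisor.pullbackRep` of `𝒪_{Y'}(Y)|_V ≅ 𝒪(e)|_V`) and `e` times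
the honest hyperplane section `V₊(m)|_{Y'} · [V]`, restricted to `Y`, differ by an element of
`Rat_d(Y)` — indeed by the push-forward of `[div]` of a rational function on `V ⊆ Y`.
[cite: HirschowitzIyer2010, §2 Lemma 2.2 (the computation of Γ · Y, p. 5)] -/
theorem quadricCubic_gysinCycle_primeCycle_sub_smul_mem_ratTrivial [LocallyOfFiniteType (quadric Q).hom]
    (he : 0 < e) (hC : C ∈ grading (Fin (n + 1)) K e) (hC0 : C ≠ 0)
    (hCη : C ∉ (quadricι Q (genericPoint (quadric Q).left)).asHomogeneousIdeal)
    {d : ℕ} {w : ↥(quadric Q).left} (hw : height w = d + 1)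
    (hPi : closure {quadricι Q w} ⊆
      ProjectiveSpectrum.zeroLocus (MvPolynomial.homogeneousSubmodule (Fin (n + 1)) K) {C})
    {m : MvPolynomial (Fin (n + 1)) K} (hm : m ∈ grading (Fin (n + 1)) K 1) (hm0 : m ≠ 0)
    (hmη : (ProjSpace.formDivisor m hm hm0).Avoids (quadricι Q (genericPoint (quadric Q).left)))
    (hmw : m ∉ (quadricι Q w).asHomogeneousIdeal) :
    CartierDivisor.gysinCycle (quadricCubicToQuadric Q C).left (cubicSection he hC hC0 hCη) (primeCycle w) -
        (e : ℤ) • cycleRestrictClosed (quadricCubicToQuadric Q C).left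
          (((ProjSpace.formDivisor m hm hm0).pullbackAvoiding (quadricι Q) hmη).primeInter w) ∈
      ratTrivial (quadricCubic Q C).left d := by
  classical
  set i := quadricCubicToQuadric Q C with hidef
  set D := cubicSection he hC hC0 hCη with hD
  set Hm := (ProjSpace.formDivisor m hm hm0).pullbackAvoiding (quadricι Q) hmη with hHm
  have hmav : (ProjSpace.formDivisor m hm hm0).Avoids (quadricι Q w) :=
    (ProjSpace.formDivisor_avoids_iff hm hm0 zero_lt_one).2 hmw
  -- the divisor `e • V₊(m)` on `ℙⁿ` and its restriction to `V₊(Q)`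
  have hEη : (e • ProjSpace.formDivisor m hm hm0).Avoids (quadricι Q (genericPoint (quadric Q).left)) :=
    hmη.smul e
  have hEw : (e • ProjSpace.formDivisor m hm hm0).Avoids (quadricι Q w) := hmav.smul e
  set DG := (e • ProjSpace.formDivisor m hm hm0).pullbackAvoiding (quadricι Q) hEη with hDG
  -- `closure {w} ⊆ V₊(Q, C)` (in `V₊(Q)`)
  have hclw : closure {w} ⊆ Set.range i.left.base := by
    intro x hx
    apply mem_range_quadricCubicToQuadric_of_mem he hC hC0 hCη
    have hιx : quadricι Q x ∈ closure {quadricι Q w} := by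
      rw [← image_closure_singleton_of_isClosedMap (quadricι Q) (quadricι Q).isClosedMap w]
      exact ⟨x, hx, rfl⟩
    exact Set.singleton_subset_iff.1 ((ProjectiveSpectrum.mem_zeroLocus _ _ _).1 (hPi hιx))
  -- the two representatives of `V₊(C)|_V` and their cycles
  set O := ClosedSubvariety.ofPoint (quadric Q).left w with hO
  have hOd : height (⊤ : ↥(O.over (quadric Q).hom).left) = d + 1 := by
    change height (⊤ : ↥(ClosedSubvariety.ofPoint (quadric Q).left w).carrier) = _
    rw [height_top_ofPoint, hw]
  have hGw : DG.Avoids w :=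
    CartierDivisor.Avoids.pullbackAvoiding_of_base (X := projectiveSpace n K) (quadricι Q) hEη hEw
  have hHmw : Hm.Avoids w :=
    CartierDivisor.Avoids.pullbackAvoiding_of_base (X := projectiveSpace n K) (quadricι Q) hmη hmav
  -- `D|_O ∼ DG|_O` (both represent the class of `V₊(C) ∼ e • H ∼ e • V₊(m)` pulled back to `O`)
  have hlin : (D.pullbackRep O.ι).LinEquiv (DG.pullbackRep O.ι) := by
    have hCG : (ProjSpace.formDivisor C hC hC0).LinEquiv (e • ProjSpace.formDivisor m hm hm0) :=
      (ProjSpace.smul_hyperplane_linEquiv_formDivisor hC hC0).symm.trans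
        ((ProjSpace.hyperplane_linEquiv_formDivisor hm hm0).smul e)
    have e1 : (D.pullbackRep O.ι).LinEquiv (D.classPullback O.ι) := (D.classPullback_linEquiv_pullbackRep O.ι).symm
    have e2 : (D.classPullback O.ι).LinEquiv (((ProjSpace.formDivisor C hC hC0).classPullback (quadricι Q)).classPullback O.ι) :=
      ((ProjSpace.formDivisor C hC hC0).classPullback_linEquiv_pullbackAvoiding (quadricι Q) _).symm.classPullback O.ι
    have e3 : (((ProjSpace.formDivisor C hC hC0).classPullback (quadricι Q)).classPullback O.ι).LinEquiv
        ((ProjSpace.formDivisor C hC hC0).classPullback (O.ι ≫ quadricι Q)) :=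
      ((ProjSpace.formDivisor C hC hC0).classPullback_comp_linEquiv (quadricι Q) O.ι).symm
    have e4 : ((ProjSpace.formDivisor C hC hC0).classPullback (O.ι ≫ quadricι Q)).LinEquiv
        ((e • ProjSpace.formDivisor m hm hm0).classPullback (O.ι ≫ quadricι Q)) := hCG.classPullback _
    have e5 : ((e • ProjSpace.formDivisor m hm hm0).classPullback (O.ι ≫ quadricι Q)).LinEquiv
        (((e • ProjSpace.formDivisor m hm hm0).classPullback (quadricι Q)).classPullback O.ι) :=
      (e • ProjSpace.formDivisor m hm hm0).classPullback_comp_linEquiv (quadricι Q) O.ι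
    have e6 : (((e • ProjSpace.formDivisor m hm hm0).classPullback (quadricι Q)).classPullback O.ι).LinEquiv
        (DG.classPullback O.ι) :=
      ((e • ProjSpace.formDivisor m hm hm0).classPullback_linEquiv_pullbackAvoiding (quadricι Q) hEη).classPullback O.ι
    have e7 : (DG.classPullback O.ι).LinEquiv (DG.pullbackRep O.ι) := DG.classPullback_linEquiv_pullbackRep O.ι
    exact (((((e1.trans e2).trans e3).trans e4).trans e5).trans e6).trans e7
  -- hence `D · [V] - DG · [V] ∈ Rat_d(V₊(Q); closure {w}) ⊆ Rat_d(V₊(Q); i(V₊(Q, C)))`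
  have hdiff : D.primeInter w - DG.primeInter w ∈ ratTrivialOn (quadric Q).left (Set.range i.left.base) d := by
    have h := (hlin.symm).cycle_sub_cycle_mem_ratTrivial (V := O.over (quadric Q).hom) hOd
    have h' := map_mem_ratTrivialOn_range_of_mem_ratTrivial O.ι h
    rw [ClosedSubvariety.range_ofPoint_ι] at h'
    refine ratTrivialOn_mono hclw ?_
    have key : D.primeInter w - DG.primeInter w = AlgebraicCycle.map O.ι height height
        ((D.pullbackRep O.ι).cycle - (DG.pullbackRep O.ι).cycle) := by
      rw [algebraicCycleMap_sub']
      rfl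
    rw [key]
    exact h'
  -- `DG · [V] = e • (V₊(m)|_{V₊(Q)} · [V])`
  have hDGe : DG.primeInter w = (e : ℤ) • Hm.primeInter w := by
    have hsame : DG.SameDivisor (e • Hm) :=
      CartierDivisor.pullbackAvoiding_smul_sameDivisor (quadricι Q) hmη e
    rw [hsame.primeInter_eq hGw, Hm.smul_primeInter hHmw e]
  -- restrict to `V₊(Q, C)`
  have h := cycleRestrictClosed_mem_ratTrivial_of_mem_ratTrivialOn i.left hdiff
  rw [CartierDivisor.gysinCycle, CartierDivisor.interCycle_primeCycle]
  have e2 : cycleRestrictClosed i.left (D.primeInter w) - (e : ℤ) • cycleRestrictClosed i.left (Hm.primeInter w) =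
      cycleRestrictClosed i.left (D.primeInter w - DG.primeInter w) := by
    rw [hDGe, ← cycleRestrictClosedHom_apply, ← cycleRestrictClosedHom_apply,
      ← cycleRestrictClosedHom_apply, map_sub, map_zsmul]
  rw [e2]
  exact h

/-- **In `CH_d(V₊(Q, C))`: `quadricCubicGysin [V] = e • [(V₊(m)|_{V₊(Q)} · [V])|_{V₊(Q,C)}]`** for a
`(d+1)`-dimensional subvariety `V = closure {w} ⊆ V₊(Q)` contained in `V₊(C)` and a linear form `m`
not vanishing on `V` — Hirschowitz–Iyer's `Γ · Y` for a cycle `Γ` lying inside `Y ∈ |𝒪_{Y'}(e)|`: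
`e` times a hyperplane section. [cite: HirschowitzIyer2010, §2 Lemma 2.2 (the computation of Γ · Y, p. 5)] -/
theorem quadricCubicGysin_mk_primeCycle_eq_smul_of_closure_subset [LocallyOfFiniteType (quadric Q).hom]
    (he : 0 < e) (hC : C ∈ grading (Fin (n + 1)) K e) (hC0 : C ≠ 0)
    (hCη : C ∉ (quadricι Q (genericPoint (quadric Q).left)).asHomogeneousIdeal)
    {d : ℕ} {w : ↥(quadric Q).left} (hw : height w = d + 1)
    (hPi : closure {quadricι Q w} ⊆
      ProjectiveSpectrum.zeroLocus (MvPolynomial.homogeneousSubmodule (Fin (n + 1)) K) {C})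
    {m : MvPolynomial (Fin (n + 1)) K} (hm : m ∈ grading (Fin (n + 1)) K 1) (hm0 : m ≠ 0)
    (hmη : (ProjSpace.formDivisor m hm hm0).Avoids (quadricι Q (genericPoint (quadric Q).left)))
    (hmw : m ∉ (quadricι Q w).asHomogeneousIdeal) :
    quadricCubicGysin he hC hC0 hCη d (QuotientAddGroup.mk ⟨primeCycle w, primeCycle_mem_cyclesOfDim hw⟩) =
      (e : ℤ) • QuotientAddGroup.mk
        (⟨cycleRestrictClosed (quadricCubicToQuadric Q C).left
            (((ProjSpace.formDivisor m hm hm0).pullbackAvoiding (quadricι Q) hmη).primeInter w),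
          cycleRestrictClosed_mem_cyclesOfDim _ (CartierDivisor.primeInter_mem_cyclesOfDim _ hw)⟩ :
          ↥(cyclesOfDim (quadricCubic Q C).left d)) := by
  have hrat := quadricCubic_gysinCycle_primeCycle_sub_smul_mem_ratTrivial he hC hC0 hCη hw hPi hm hm0 hmη hmw
  rw [quadricCubicGysin, CartierDivisor.IsEffective.gysin_mk]
  have hx : (QuotientAddGroup.mk (⟨CartierDivisor.gysinCycle (quadricCubicToQuadric Q C).left
      (cubicSection he hC hC0 hCη) (primeCycle w),
      CartierDivisor.gysinCycle_mem_cyclesOfDim _ _ (primeCycle_mem_cyclesOfDim hw)⟩ :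
        ↥(cyclesOfDim (quadricCubic Q C).left d)) : ChowGroup (quadricCubic Q C).left d) =
      QuotientAddGroup.mk ((e : ℤ) • (⟨cycleRestrictClosed (quadricCubicToQuadric Q C).left
            (((ProjSpace.formDivisor m hm hm0).pullbackAvoiding (quadricι Q) hmη).primeInter w),
          cycleRestrictClosed_mem_cyclesOfDim _ (CartierDivisor.primeInter_mem_cyclesOfDim _ hw)⟩ :
          ↥(cyclesOfDim (quadricCubic Q C).left d))) := by
    apply (QuotientAddGroup.eq_iff_sub_mem).mpr
    exact hrat
  exact hx.trans rfl

end Inside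

end Literature.AlgebraicGeometry.Motives

end
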